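import Summits.QuantumFields.YangMills.Theorems.ConvexGribovBodyCovarianceBoundDefs

/-!
# CovarianceBound — round-2 ideator 5: typed companions of `FindingsIdeator5.md`

Nothing here restates or weakens the crux. Vocabulary = the landed `SupportWindow` defs
(`coulombF`, `IsCoulMin`, `modeCov`, `supCov`, `wilson4`, `froSq`). Contents:

* `whiteLevel`, `WhiteEndpoint` — (L1-a) the exact hot-gauge endpoint of stochastic gauge fixing:
  averaging the crux's integrand over a Haar-random gauge transformation gives `3·w(r)` for EVERY
  configuration, momentum and volume (landable, M-sized: Haar invariance + vanishing of cross terms).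
* `softGaugeMeasure`, `softCov`, `TotalPowerMonotone` (true, Parseval level) and `ModewiseMonotone`
  (the class-(2) "monotonicity in the gauge temperature" statement — predicted FALSE: spread toron at
  fixed volume; weak-coupling soft window `|p| ≲ g²` in large volume; recorded so nobody files it).
* `FemtoToronFloor`, `CovarianceBoundUniformInBeta`, `not_uniformInBeta_of_femtoToronFloor` (PROVED,
  pure logic) — (N-b) for the disprover: a fixed-volume `β → ∞` floor `≥ c·(2S+1)` at `p = 0` forces the
  crux's constant `D(β)` (equivalently `S₀(β)`) to diverge with `β`; the `β`-uniform strengthening is then false.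
* `LipschitzEnvelope` — (L2) the inf-convolution device that makes suprema over near-minimisers Lipschitz
  (defeats the BV/jump objection N3(ii) for Dirichlet-form methods; abstract metric-space form).
-/

set_option autoImplicit false

namespace Summit.QuantumFields.YangMills.Cruxes.CovarianceBound.Ideator5

open scoped Matrix BigOperators
open MeasureTheory
open Literature.MathematicalPhysics.QuantumFieldTheory
open Summit.QuantumFields.YangMills.Cruxes.CovarianceBound.SupportWindow

noncomputable section

variable {G : Type} [Group G] [TopologicalSpace G] [IsTopologicalGroup G] [CompactSpace G]
  [MeasurableSpace G] [BorelSpace G]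

/-! ## (L1) Stochastic (soft) gauge fixing: the exact white endpoint and the monotonicity question -/

/-- White level of a lattice representation: `w(r) = ∫_G ‖½(ρ(g) − ρ(g)ᴴ)‖²_F dg` (for `SU(2)`
fundamental `w = 3/2`: `‖i c⃗·σ⃗‖²_F = 2|c⃗|²`, `E|c⃗|² = 3/4` on `S³`). -/
def whiteLevel (r : LatticeRep G) : ℝ :=
  ∫ g, froSq ((1 / 2 : ℂ) • (r.ρ g - (r.ρ g)ᴴ)) ∂(haarProbability G)

/-- Product Haar probability on gauge transformations of the torus `(2S+1)⁴` ("hot gauge", `α = 0`). -/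
def haarGauge (G : Type) [Group G] [TopologicalSpace G] [IsTopologicalGroup G] [CompactSpace G]
    [MeasurableSpace G] [BorelSpace G] (S : ℕ) : Measure (Site 4 (2 * S + 1) → G) :=
  Measure.pi fun _ : Site 4 (2 * S + 1) => haarProbability G

/-- **(L1-a) White endpoint** (exact, configuration by configuration): for every `U`, `p` and every
`S ≥ 1`, `∫ cov(U,h,p) dHaar^{sites}(h) = 3·w(r)`. Proof sketch: for fixed `U` and Haar-i.i.d. `h`, each
gauge-transformed slice link `h(y) U_{y,j} h(y+ĵ)⁻¹` is Haar-distributed (translation invariance in the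
endpoint variable); two distinct slice links of a torus of side `≥ 3` share at most one endpoint, so one
endpoint variable of the first can be integrated out first, which makes its anti-Hermitian part
Haar-centred — `∫ ½(ρg − ρgᴴ) dg = ½(P − Pᴴ) = 0`, `P` the (self-adjoint) projection on `ρ`-invariants —
and independent of the second: only the `3(2S+1)³` diagonal terms of `Σ_j ‖Â_j(p)‖²_F` survive. (False at
`S = 0`: on the one-site torus the links are loops and `h` acts by conjugation.) -/
def WhiteEndpoint : Prop :=
  ∀ (G : Type) [Group G] [TopologicalSpace G] [IsTopologicalGroup G] [CompactSpace G]
    [MeasurableSpace G] [BorelSpace G] (r : LatticeRep G) (S : ℕ), 1 ≤ S →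
    ∀ (U : GaugeConfig 4 (2 * S + 1) G) (p : Fin 3 → ZMod (2 * S + 1)),
    ∫ h, modeCov r S U h p ∂(haarGauge G S) = 3 * whiteLevel r

/-- Soft (stochastic) gauge fixing at gauge temperature `1/α` (Zwanziger 1981; Parrinello–Jona-Lasinio):
the Gibbs probability on gauge transformations with density `∝ exp(−α·coul(U,h))` w.r.t. product Haar.
`α = 0` is the hot gauge; `α → ∞` concentrates on the ABSOLUTE minimisers (Laplace), i.e. on the
fundamental modular region — the crux's gauge — and equals the crux's `sup` there whenever the absolute
minimiser is unique modulo global `G` (expected Haar-a.e.; listed by the route under "not decomposed yet"). -/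
def softGaugeMeasure (r : LatticeRep G) (S : ℕ) (α : ℝ) (U : GaugeConfig 4 (2 * S + 1) G) :
    Measure (Site 4 (2 * S + 1) → G) :=
  (∫⁻ h, ENNReal.ofReal (Real.exp (-α * coulombF r S U h)) ∂(haarGauge G S))⁻¹ •
    (haarGauge G S).withDensity fun h => ENNReal.ofReal (Real.exp (-α * coulombF r S U h))

/-- `D_α(p)`: the quenched soft-gauge covariance (Wilson average outside, soft-gauge Gibbs average inside). -/
def softCov (r : LatticeRep G) (β α : ℝ) (S : ℕ) (p : Fin 3 → ZMod (2 * S + 1)) : ℝ :=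
  ∫ U, (∫ h, modeCov r S U h p ∂(softGaugeMeasure r S α U)) ∂(wilson4 r β S)

/-- **(L1-b) Parseval-level monotonicity** (TRUE, exact): `α ↦ Σ_p D_α(p)` is non-increasing, because
`Σ_p cov(U,h,p) = Σ_{slice links} ‖A‖²_F` is an affine function of `coul(U,h)` plus a bounded `h`-independent
term up to the `𝔤^⊥`/trace bookkeeping, and `d⟨coul⟩_α/dα = −Var_α(coul) ≤ 0` for every `U`. Stated as
the monotonicity of the total power. -/
def TotalPowerMonotone : Prop :=
  ∀ (G : Type) [Group G] [TopologicalSpace G] [IsTopologicalGroup G] [CompactSpace G]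
    [MeasurableSpace G] [BorelSpace G] (r : LatticeRep G) (β : ℝ) (S : ℕ) (α α' : ℝ),
    0 ≤ α → α ≤ α' →
      ∑ p : Fin 3 → ZMod (2 * S + 1), softCov r β α' S p ≤ ∑ p : Fin 3 → ZMod (2 * S + 1), softCov r β α S p

/-- **(L1-c) Mode-wise monotonicity in the gauge temperature** — the class-(2) "correlation/monotonicity
inequality for soft minimal-gauge fields" that WOULD give the crux with `D = 3·w(r)` (white endpoint +
`α → ∞`). Predicted FALSE and recorded so that nobody files it: (i) at fixed volume on the spread toron
`D_α(0)` rises from `3w` to `≈ 2π²(2S+1)` as `α → ∞` (gauge cooling CREATES the coherent zero mode);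
(ii) in large volume at weak coupling the minimal gauge is infrared-HEAVY, `D_∞(p) ≈ g²/(2ω̂_p) ≫ 3w`
for `|p̂| ≲ g²/(2N)`, while `D_0 ≡ 3w` (cooling pumps the reduced total power into soft modes). -/
def ModewiseMonotone : Prop :=
  ∀ (G : Type) [Group G] [TopologicalSpace G] [IsTopologicalGroup G] [CompactSpace G]
    [MeasurableSpace G] [BorelSpace G], IsCompactSimpleLieGroup G → ∀ (r : LatticeRep G),
    ∃ β₀ : ℝ, ∀ β : ℝ, β₀ ≤ β → ∃ S₀ : ℕ, ∀ S : ℕ, S₀ ≤ S → ∀ (α α' : ℝ), 0 ≤ α → α ≤ α' →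
      ∀ p : Fin 3 → ZMod (2 * S + 1), softCov r β α' S p ≤ softCov r β α S p

/-! ## (N-b) The femto-universe floor forces `D(β) → ∞` (for the standing disprover) -/

/-- **Femto toron floor** at `(G, r)`: at FIXED volume, for all sufficiently weak coupling, the
zero-momentum integrand of the crux is `≥ c·(2S+1)`. Expected TRUE for `SU(2)` fundamental with an
ELEMENTARY proof (no Laplace asymptotics): (1) exact finite-volume centre symmetry (flip the sign of all
direction-1 links on the sheet `y₁ = 0`; every plaquette contains 0 or 2 of them) preserves `wilson4` and
sends the `S³`-angle `θ = ang(Ω₁)` of the holonomy of a fixed direction-1 line to `π − θ`, hence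
`P(θ ≥ π/2) ≥ 1/2` for every `β, S`; (2) as `β → ∞` at fixed `S` the action tends to `0` in probability
(`P(S_W ≥ δ) ≤ e^{−βδ/2}/Haar{S_W ≤ δ/2}`), so by compactness the slice is uniformly close to a gauge
transform of a FLAT slice configuration whose direction-1 holonomy has angle `θ ≥ π/2` with probability
`≥ 1/2 − o(1)`; (3) for such a flat configuration EVERY absolute Coulomb minimiser is the `θ`-spread
toron up to global `G` (the disprover's angle inequality `Σ ang ≥ θ` along each line, concavity of `cos`,
and the equality case of the triangle inequality on the round `S³`, which forces collinear geodesic chains;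
axis flips between neighbouring lines cost a Weyl element on transverse links), with
`cov(·,·,0) = 2L³ sin²(θ/L) ≥ 2L³ sin²(π/(2L)) ≥ 2L` (`sin x ≥ 2x/π`); (4) upper hemicontinuity of the
argmin correspondence (Berge) and continuity of `cov` give `lim inf` of the `sup` at nearby configurations,
so `∫ sup_{argmin} cov(·,·,0) ≥ (1/2 − o(1))·2L ≥ c(2S+1)`. (`le_cov_toron`/`coul_toron_one_le` are the
`θ = π` instance of (3).) -/
def FemtoToronFloor (r : LatticeRep G) : Prop :=
  ∃ c : ℝ, 0 < c ∧ ∀ S : ℕ, 2 ≤ S → ∃ β₁ : ℝ, ∀ β : ℝ, β₁ ≤ β →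
    c * (2 * S + 1) ≤ ∫ U, supCov r S 0 U ∂(wilson4 r β S)

/-- The `β`-UNIFORM strengthening of the crux at `(G, r)`: `D` and `S₀` chosen before `β`. -/
def CovarianceBoundUniformInBeta (r : LatticeRep G) : Prop :=
  ∃ β₀ D : ℝ, ∃ S₀ : ℕ, ∀ β : ℝ, β₀ ≤ β → ∀ S : ℕ, S₀ ≤ S →
    ∀ p : Fin 3 → ZMod (2 * S + 1), ∫ U, supCov r S p U ∂(wilson4 r β S) ≤ D

/-- **The floor kills the `β`-uniform strengthening** (pure logic): under `FemtoToronFloor r` the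
constant `D` of `CovarianceBound` at `(G,r)` cannot be chosen independently of `β` — it must grow at
least like the largest side `2S+1` whose `β₁(S)` lies below `β` (physically `D(β) ≍ g²/(2√2·M(β)a) → ∞`). -/
theorem not_uniformInBeta_of_femtoToronFloor (r : LatticeRep G) (h : FemtoToronFloor r) :
    ¬ CovarianceBoundUniformInBeta r := by
  rintro ⟨β₀, D, S₀, hD⟩
  obtain ⟨c, hc, hS⟩ := h
  -- a side large enough that the floor exceeds `D`
  obtain ⟨n, hn⟩ := exists_nat_gt (D / c)
  set S : ℕ := max (max S₀ 2) n with hSdef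
  have hS₀ : S₀ ≤ S := le_trans (le_max_left _ _) (le_max_left _ _)
  have h2 : 2 ≤ S := le_trans (le_max_right _ _) (le_max_left _ _)
  have hnS : n ≤ S := le_max_right _ _
  obtain ⟨β₁, hβ₁⟩ := hS S h2
  have hfloor := hβ₁ (max β₀ β₁) (le_max_right _ _)
  have hceil := hD (max β₀ β₁) (le_max_left _ _) S hS₀ 0
  have hlt : D < c * (2 * S + 1) := by
    have h1 : D / c < (S : ℝ) := lt_of_lt_of_le hn (by exact_mod_cast hnS)
    have h2' : D < c * (S : ℝ) := by
      rw [div_lt_iff₀ hc] at h1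
      linarith [mul_comm (S : ℝ) c]
    have h3 : c * (S : ℝ) ≤ c * (2 * S + 1) := by
      apply mul_le_mul_of_nonneg_left _ hc.le
      have : (0 : ℝ) ≤ S := Nat.cast_nonneg S
      linarith
    linarith
  linarith

/-! ## (L2) The Lipschitz envelope of near-minimiser suprema (abstract device) -/

/-- **Lipschitz envelope lemma** (abstract form, elementary). `c x y` a cost, 1-Lipschitz in `x`
uniformly in `y`; `F x y` a statistic, `K`-Lipschitz in `x` uniformly in `y` and bounded above; `m x` the
infimal cost. The near-minimiser supremum `R ε x = sup {F x y : c x y ≤ m x + ε}` is only "shift-Lipschitz"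
(`R ε x ≤ R (ε + 2 d(x,x')) x' + K d(x,x')`), but its inf-convolution in `ε`,
`Ψ x = inf_{ε ≥ 0} (R ε x + lam·ε)`, is genuinely `(2·lam + K)`-Lipschitz and sandwiches the argmin
supremum: `R 0 x ≤ Ψ x ≤ R ε x + lam·ε` for every `ε ≥ 0`. Applied with `x = U` (ℓ¹-Frobenius metric on
slice links), `y = h`, `c = coul`, `F = ‖Ĝ_p(U,h)‖` it turns the crux's u.s.c.-with-jumps integrand into
an O(1)-Lipschitz gauge-invariant function of the slice links, at the price of the near-minimiser
oscillation `R ε − R 0` (the "rigidity defect"). -/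
def LipschitzEnvelope : Prop :=
  ∀ (X Y : Type) [PseudoMetricSpace X] [Nonempty Y] (c F : X → Y → ℝ) (K lam B : ℝ),
    0 ≤ K → 0 < lam →
    (∀ y x x', |c x y - c x' y| ≤ dist x x') →
    (∀ y x x', |F x y - F x' y| ≤ K * dist x x') →
    (∀ x y, F x y ≤ B) → (∀ x, BddBelow (Set.range (c x))) →
    let m : X → ℝ := fun x => ⨅ y, c x y
    let R : ℝ → X → ℝ := fun ε x => sSup ((fun y => F x y) '' {y | c x y ≤ m x + ε})
    let Ψ : X → ℝ := fun x => ⨅ ε : {ε : ℝ // 0 ≤ ε}, R ε.1 x + lam * ε.1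
    (∀ x x', |Ψ x - Ψ x'| ≤ (2 * lam + K) * dist x x') ∧
      (∀ x, (∃ y, c x y = m x) → R 0 x ≤ Ψ x) ∧ (∀ x (ε : ℝ), 0 ≤ ε → Ψ x ≤ R ε x + lam * ε)

end

end Summit.QuantumFields.YangMills.Cruxes.CovarianceBound.Ideator5
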